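/-
Copyright (c) 2026. All rights reserved.
Released under Apache 2.0 license as described in the file LICENSE.
Authors: abc-iut cell, cone prover seat abc-iut-w6-d028 (wave W6, block C).
-/
import Literature.AnabelianGeometry.SemiGraphs.TemperedAbsoluteness
import Literature.AnabelianGeometry.SemiGraphs.TemperedAnabelianWitness
import HarnessLib

/-!
# [SemiAnbd] §6 Cor. 6.10 / Cor. 6.11 / Thm. 6.12 over the origin certificate `AbsolutenessOrigin`:
# the universal closures are FALSE, the statements are (vacuously) SATISFIABLE — schema verdicts

Mochizuki, *Semi-graphs of anabelioids*, Publ. RIMS **42** (2006) [SemiAnbd], §6 pp. 77–78 (author's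
ms.): Cor. 6.10 (Tempered Absoluteness), Cor. 6.11 (Unitwise and Integral Temp-absoluteness for Genus
Zero), Thm. 6.12 (Rigidity of Cuspidal Geometric Decomposition Groups). [cite: MochizukiSemiAnbd2006, §6 pp.77-78]

PROOF-ONLY companion (no `def`, no instance, nothing restated) of abc-iut-L3's `TemperedAbsoluteness.lean`
(the typed nodes `AbsolutenessOrigin.TemperedAbsolutenessHolds` = Cor. 6.10, `.GenusZeroTempAbsolutenessHolds`
= Cor. 6.11, `.CuspidalCyclotomicRigidityHolds` = Thm. 6.12; FACT-LIST rows F-1656, F-1655, F-1653).  Each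
typed node is a predicate on an ORIGIN CERTIFICATE `Ω : AbsolutenessOrigin p` ("`X` IS a hyperbolic curve",
"`k` IS the Kummer datum", …; threaded as a parameter, never constructed), asserting the printed statement
for the data `Ω` certifies.  The FACT-LIST's universal closure quantifies over ALL certificates `Ω`; this
file DECIDES the closures of Cor. 6.10 and Cor. 6.11 (both FALSE; Thm. 6.12's closure is refuted in the
sibling file `TemperedAbsolutenessCyclotomicRigiditySchemaNegative.lean`, over abc-iut-w5-d040's cyclotome
witnesses) and records that each of the three nodes is satisfiable (vacuously, at any certificate that
certifies no curve):

* `not_forall_genusZeroTempAbsolutenessHolds` (F-1655): at the all-certifying certificate, the degenerate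
  §6 datum (no closed points) with the flags "stable reduction", "isogenous to genus zero" set and the junk
  Kummer datum `H¹ := ℤ ⊇ ⊤` is not unitwise temp-absolute (transport `id` to the datum `ℤ ⊇ ⊥`);
* `not_forall_temperedAbsolutenessHolds` (F-1656): at the ADVERSARIAL certificate that certifies exactly the
  transports whose TEMPERED component preserves unit images, the junk Kummer datum `ℤ × ℤ ⊇ ℤ × 0` on the
  degenerate §6 datum is unitwise temp-absolute but not unitwise absolute (certified transport with profinite
  component the coordinate swap), so "unitwise absolute ↔ unitwise temp-absolute" (Cor. 6.10 (ii)) fails;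
* `…_of_forall_not` / `exists_…` : each node holds at every certificate certifying no curve.

HONEST FRAMING: a refuted universal closure over certificates and junk data is a statement about the
INTERFACE (the certificate is a free parameter), not about the printed Cor. 6.10 / 6.11 / Thm. 6.12, which
concern hyperbolic curves with their genuine [Mzk8] §4 structures; these nodes must be consumed at the
genuine certificate, as designed.  No side is taken on [IUTchIII] Cor. 3.12; typed ≠ proved; schema-refuted
≠ refuted.
-/

noncomputable section

namespace Literature.AnabelianGeometry.SemiGraphs

namespace AbsolutenessOrigin

variable (p : ℕ) [Fact p.Prime]

/-! ### Satisfiability: certificates certifying no curve -/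

/-- Cor. 6.10 as typed holds at every certificate that certifies no curve (vacuously).
[cite: MochizukiSemiAnbd2006, Cor 6.10 p.77] -/
theorem temperedAbsolutenessHolds_of_forall_not (Ω : AbsolutenessOrigin p)
    (hΩ : ∀ X : TemperedCurve p, ¬ Ω.IsHyperbolicCurveOrigin X) : Ω.TemperedAbsolutenessHolds :=
  fun X _ _ hX _ _ => (hΩ X hX).elim

/-- Cor. 6.11 as typed holds at every certificate that certifies no curve (vacuously).
[cite: MochizukiSemiAnbd2006, Cor 6.11 p.77] -/
theorem genusZeroTempAbsolutenessHolds_of_forall_not (Ω : AbsolutenessOrigin p)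
    (hΩ : ∀ X : TemperedCurve p, ¬ Ω.IsHyperbolicCurveOrigin X) : Ω.GenusZeroTempAbsolutenessHolds :=
  fun X _ _ _ hX _ _ _ => (hΩ X hX).elim

/-- Thm. 6.12 as typed holds at every certificate that certifies no curve (vacuously).
[cite: MochizukiSemiAnbd2006, Thm 6.12 p.78] -/
theorem cuspidalCyclotomicRigidityHolds_of_forall_not (Ω : AbsolutenessOrigin p)
    (hΩ : ∀ X : TemperedCurve p, ¬ Ω.IsHyperbolicCurveOrigin X) : Ω.CuspidalCyclotomicRigidityHolds :=
  fun X _ _ hX _ _ => (hΩ X hX).elim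

/-- SATISFIABLE: some certificate (the empty one) satisfies all three typed nodes Cor. 6.10, Cor. 6.11,
Thm. 6.12 simultaneously. [cite: MochizukiSemiAnbd2006, §6 pp.77-78] -/
theorem exists_temperedAbsoluteness_genusZero_cyclotomicRigidity_holds :
    ∃ Ω : AbsolutenessOrigin p, Ω.TemperedAbsolutenessHolds ∧ Ω.GenusZeroTempAbsolutenessHolds ∧
      Ω.CuspidalCyclotomicRigidityHolds := by
  let Ω : AbsolutenessOrigin p :=
    { IsHyperbolicCurveOrigin := fun _ => False
      IsDomHomOrigin := fun _ => False
      IsDLocOrigin := fun _ => False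
      IsFlagsOrigin := fun _ => False
      IsStructuresOrigin := fun _ => False
      IsKummerOrigin := fun _ => False
      IsKummerTransportOrigin := fun _ => False
      IsCyclotomeOrigin := fun _ => False }
  exact ⟨Ω, temperedAbsolutenessHolds_of_forall_not p Ω fun _ h => h,
    genusZeroTempAbsolutenessHolds_of_forall_not p Ω fun _ h => h,
    cuspidalCyclotomicRigidityHolds_of_forall_not p Ω fun _ h => h⟩

/-! ### The universal closures are false -/

/-- **F-1655, universal closure REFUTED.** Not every certificate satisfies Cor. 6.11 as typed: at the
all-certifying certificate, the degenerate §6 datum (no closed points) with the flags "has stable reduction"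
and "isogenous to genus zero" set and the junk Kummer datum `H¹ := ℤ`, unit image `⊤`, is NOT unitwise
temp-absolute — transport along the identity to the datum with unit image `⊥` does not preserve unit images.
[cite: MochizukiSemiAnbd2006, Cor 6.11 p.77] -/
theorem not_forall_genusZeroTempAbsolutenessHolds :
    ¬ ∀ Ω : AbsolutenessOrigin p, Ω.GenusZeroTempAbsolutenessHolds := by
  intro h
  let Ω : AbsolutenessOrigin p :=
    { IsHyperbolicCurveOrigin := fun _ => True
      IsDomHomOrigin := fun _ => True
      IsDLocOrigin := fun _ => True
      IsFlagsOrigin := fun _ => True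
      IsStructuresOrigin := fun _ => True
      IsKummerOrigin := fun _ => True
      IsKummerTransportOrigin := fun _ => True
      IsCyclotomeOrigin := fun _ => True }
  haveI := TemperedCurve.degenerate_isEmpty_pt p
  let X : TemperedCurve p := TemperedCurve.degenerate p
  let SX : CuspidalStructures X :=
    { HasStableReduction := True
      canonicalIntegral := fun x => isEmptyElim x
      canonicalDiscrete := fun x => isEmptyElim x
      canonicalIntegral_subset := fun x => isEmptyElim x
      isSplitting_of_mem := fun x => isEmptyElim x
      canonicalDiscrete_nonempty := fun x => isEmptyElim x
      canonicalIntegral_nonempty := fun _ x => isEmptyElim x }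
  let kX : KummerUnitData X := { H1 := ℤ, unitImage := ⊤ }
  let aX : TemperedCurve.CurveArithmeticFlags X :=
    { IsOncePuncturedElliptic := True
      IsTorsionPt := fun _ => True
      IsIsogenousToGenusZero := True
      IsAlgebraicPt := fun _ => True
      IsDefinedOverNumberField := True }
  have hU : Ω.IsUnitwiseTempAbsolute kX :=
    (h Ω X SX kX aX trivial trivial trivial trivial trivial trivial).1
  let kY : KummerUnitData X := { H1 := ℤ, unitImage := ⊥ }
  let t : KummerTransport kX kY :=
    { h1OfTemp := fun _ => AddEquiv.refl ℤ
      h1OfHat := fun _ => AddEquiv.refl ℤ }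
  have hmap : (⊤ : AddSubgroup ℤ).map (AddEquiv.refl ℤ).toAddMonoidHom = ⊥ :=
    hU X kY t trivial trivial trivial (ContinuousMulEquiv.refl _)
  have h1 : (1 : ℤ) ∈ (⊥ : AddSubgroup ℤ) := by
    rw [← hmap]
    exact ⟨1, trivial, rfl⟩
  exact one_ne_zero ((AddSubgroup.mem_bot).1 h1)

/-- **F-1656, universal closure REFUTED.** Not every certificate satisfies Cor. 6.10 as typed: take the
ADVERSARIAL certificate certifying every curve, structure and Kummer datum, and exactly those transports
whose TEMPERED component preserves unit images.  For the junk Kummer datum `H¹ := ℤ × ℤ ⊇ ℤ × 0` on the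
degenerate §6 datum, "unitwise temp-absolute" holds (by the certificate), but the certified transport
(tempered component `id`, profinite component the coordinate swap) moves `ℤ × 0` to `0 × ℤ`, so "unitwise
absolute" fails — Cor. 6.10 (ii)'s "unitwise absolute ↔ unitwise temp-absolute" fails as typed.
[cite: MochizukiSemiAnbd2006, Cor 6.10(ii) p.77] -/
theorem not_forall_temperedAbsolutenessHolds :
    ¬ ∀ Ω : AbsolutenessOrigin p, Ω.TemperedAbsolutenessHolds := by
  intro h
  let Ω : AbsolutenessOrigin p :=
    { IsHyperbolicCurveOrigin := fun _ => True
      IsDomHomOrigin := fun _ => True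
      IsDLocOrigin := fun _ => True
      IsFlagsOrigin := fun _ => True
      IsStructuresOrigin := fun _ => True
      IsKummerOrigin := fun _ => True
      IsKummerTransportOrigin := fun {X Y kX kY} t =>
        ∀ α : X.PiTemp ≃ₜ* Y.PiTemp, kX.unitImage.map (t.h1OfTemp α).toAddMonoidHom = kY.unitImage
      IsCyclotomeOrigin := fun _ => True }
  haveI := TemperedCurve.degenerate_isEmpty_pt p
  let X : TemperedCurve p := TemperedCurve.degenerate p
  let SX : CuspidalStructures X :=
    { HasStableReduction := True
      canonicalIntegral := fun x => isEmptyElim x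
      canonicalDiscrete := fun x => isEmptyElim x
      canonicalIntegral_subset := fun x => isEmptyElim x
      isSplitting_of_mem := fun x => isEmptyElim x
      canonicalDiscrete_nonempty := fun x => isEmptyElim x
      canonicalIntegral_nonempty := fun _ x => isEmptyElim x }
  let U : AddSubgroup (ℤ × ℤ) := (⊤ : AddSubgroup ℤ).prod ⊥
  let kX : KummerUnitData X := { H1 := ℤ × ℤ, unitImage := U }
  have hiff : Ω.IsUnitwiseAbsolute kX ↔ Ω.IsUnitwiseTempAbsolute kX :=
    (h Ω X SX kX trivial trivial trivial).2
  have htemp : Ω.IsUnitwiseTempAbsolute kX := fun _ _ _ _ _ ht α => ht α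
  have habs : Ω.IsUnitwiseAbsolute kX := hiff.2 htemp
  let t : KummerTransport kX kX :=
    { h1OfTemp := fun _ => AddEquiv.refl (ℤ × ℤ)
      h1OfHat := fun _ => AddEquiv.prodComm }
  have ht : Ω.IsKummerTransportOrigin t := fun _ => AddSubgroup.map_id U
  have hmap : U.map (AddEquiv.prodComm : ℤ × ℤ ≃+ ℤ × ℤ).toAddMonoidHom = U :=
    habs X kX t trivial trivial ht (ContinuousMulEquiv.refl _)
  have hmem : ((0 : ℤ), (1 : ℤ)) ∈ U.map (AddEquiv.prodComm : ℤ × ℤ ≃+ ℤ × ℤ).toAddMonoidHom :=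
    ⟨(1, 0), AddSubgroup.mem_prod.2 ⟨trivial, (AddSubgroup.mem_bot).2 rfl⟩, rfl⟩
  rw [hmap] at hmem
  exact one_ne_zero ((AddSubgroup.mem_bot).1 (AddSubgroup.mem_prod.1 hmem).2)

end AbsolutenessOrigin

end Literature.AnabelianGeometry.SemiGraphs

end
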